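import Summits.ResolutionOfSingularities.ResolutionOfSingularities.Theorems.WeightedInvariantIota3NoCancellation
import HarnessLib

/-!
# A `κ`-RATIONAL ROOT FROM A ROOT CURVE: `Σ_c λ_c W^{ν−c} τ₀^c = 0` in `κ[X]` with `deg W ≥ 1`, `λ_ν ≠ 0` forces `τ₀ = a·W` with `φ(a) = 0`
# (door `HypersurfaceCentreConstruction`, stmt-ResolutionOfSingularities-19897; step (1) of LEMMA C′ for `r₂ ∣ r₁`, memo RESIDUE-PLAN.md §3b)

Helper for `stub_keyRungGrHomLE_three` (def-free, `--supports 19897`).  Pure one-variable polynomial algebra over a field: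
`Polynomial3.taylor_rootCurve` (the binomial re-expansion of `Σ_c C(λ_c) W^{ν−c} τ₀^c` around `τ₀ = aW + δ`) and
**`Polynomial3.exists_root_of_rootCurve`**: if `Σ_{c ≤ ν} C(λ_c) W^{ν−c} τ₀^c = 0` with `0 < deg W`, `λ_ν ≠ 0`, then `τ₀ = C a * W` for an `a ∈ κ`
with `Σ_c λ_c a^c = 0` (degrees force `deg τ₀ = deg W`; the remainder `δ = τ₀ − aW` of smaller degree must vanish by no-cancellation).
In the root-curve proof of LEMMA C′ this is applied to the specialisation `V = Y = 0` of the functional equation (`W = ε^ρ X^{jρ}`, `τ₀ = τ(X,0)`).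
[OURS · L1 W4.3 · (o70-b)/(Δ12); AI work, weaker than expert review; nothing here is a statement of the manuscript under review.]
-/

noncomputable section

open Polynomial

set_option linter.dupNamespace false -- mandated namespace of this single-conjunct summit

namespace Summit.ResolutionOfSingularities.ResolutionOfSingularities.Cruxes.HypersurfaceCentreConstruction.LocalEngine

namespace Iota3

namespace Polynomial3

variable {κ : Type} [Field κ]

/-- **Binomial re-expansion around `aW`**: with `δ = τ₀ − C a * W`,
`Σ_{c ≤ ν} C(λ_c) W^{ν−c} τ₀^c = Σ_{i ≤ ν} C(Σ_{c ≤ ν} λ_c·(c choose i)·a^{c−i}) W^{ν−i} δ^i`. [folklore] -/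
theorem taylor_rootCurve (ν : ℕ) (lam : ℕ → κ) (W τ₀ : κ[X]) (a : κ) :
    ∑ c ∈ Finset.range (ν + 1), C (lam c) * W ^ (ν - c) * τ₀ ^ c =
      ∑ i ∈ Finset.range (ν + 1), C (∑ c ∈ Finset.range (ν + 1), lam c * (c.choose i : κ) * a ^ (c - i)) *
        W ^ (ν - i) * (τ₀ - C a * W) ^ i := by
  classical
  set δ := τ₀ - C a * W with hδ
  have hτ : τ₀ = δ + C a * W := by rw [hδ]; ring
  -- expand `τ₀^c` binomially with the inner sum extended to `range (ν+1)`
  have hexp : ∀ c ∈ Finset.range (ν + 1), C (lam c) * W ^ (ν - c) * τ₀ ^ c =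
      ∑ i ∈ Finset.range (ν + 1), C (lam c * (c.choose i : κ) * a ^ (c - i)) * W ^ (ν - i) * δ ^ i := by
    intro c hc
    have hcν : c ≤ ν := Nat.lt_succ_iff.mp (Finset.mem_range.mp hc)
    rw [hτ, add_pow, Finset.mul_sum]
    rw [← Finset.sum_subset (Finset.range_subset_range.mpr (Nat.succ_le_succ hcν)) (fun i hi hni => by
      have hic : c < i := by
        rw [Finset.mem_range] at hi hni; omega
      rw [Nat.choose_eq_zero_of_lt hic]; simp)]
    refine Finset.sum_congr rfl fun i hi => ?_
    have hic : i ≤ c := Nat.lt_succ_iff.mp (Finset.mem_range.mp hi)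
    have hW : W ^ (ν - c) * (C a * W) ^ (c - i) = C (a ^ (c - i)) * W ^ (ν - i) := by
      rw [mul_pow, ← map_pow, ← mul_assoc, mul_comm (W ^ (ν - c)), mul_assoc, ← pow_add,
        show ν - c + (c - i) = ν - i by omega]
    rw [map_mul, map_mul, map_natCast]
    calc C (lam c) * W ^ (ν - c) * (δ ^ i * (C a * W) ^ (c - i) * (c.choose i : κ[X]))
        = C (lam c) * (c.choose i : κ[X]) * (W ^ (ν - c) * (C a * W) ^ (c - i)) * δ ^ i := by ring
      _ = C (lam c) * (c.choose i : κ[X]) * C (a ^ (c - i)) * W ^ (ν - i) * δ ^ i := by rw [hW]; ring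
  rw [Finset.sum_congr rfl hexp, Finset.sum_comm]
  refine Finset.sum_congr rfl fun i _ => ?_
  rw [map_sum, Finset.sum_mul, Finset.sum_mul]

/-- Degrees of the terms `C(λ_c) W^{ν−c} P^c` are injective in `c` when `deg P ≠ deg W` (non-zero terms). [folklore] -/
theorem natDegree_term_injOn {ν : ℕ} {lam : ℕ → κ} {W P : κ[X]} (hW0 : W ≠ 0) (hP0 : P ≠ 0) (hd : P.natDegree ≠ W.natDegree) :
    ∀ c ∈ Finset.range (ν + 1), ∀ c' ∈ Finset.range (ν + 1), c ≠ c' →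
      C (lam c) * W ^ (ν - c) * P ^ c ≠ 0 → C (lam c') * W ^ (ν - c') * P ^ c' ≠ 0 →
      (C (lam c) * W ^ (ν - c) * P ^ c).natDegree ≠ (C (lam c') * W ^ (ν - c') * P ^ c').natDegree := by
  intro c hc c' hc' hcc' hf hf' heq
  have hcν : c ≤ ν := Nat.lt_succ_iff.mp (Finset.mem_range.mp hc)
  have hc'ν : c' ≤ ν := Nat.lt_succ_iff.mp (Finset.mem_range.mp hc')
  have hl : lam c ≠ 0 := by rintro h; rw [h, map_zero, zero_mul, zero_mul] at hf; exact hf rfl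
  have hl' : lam c' ≠ 0 := by rintro h; rw [h, map_zero, zero_mul, zero_mul] at hf'; exact hf' rfl
  have hdeg : ∀ k, k ≤ ν → lam k ≠ 0 → (C (lam k) * W ^ (ν - k) * P ^ k).natDegree = (ν - k) * W.natDegree + k * P.natDegree := by
    intro k hk hlk
    rw [natDegree_mul (mul_ne_zero (by rwa [Ne, C_eq_zero]) (pow_ne_zero _ hW0)) (pow_ne_zero _ hP0),
      natDegree_C_mul hlk, natDegree_pow, natDegree_pow]
  rw [hdeg c hcν hl, hdeg c' hc'ν hl'] at heq
  -- `(ν−c)D + c d = (ν−c')D + c' d` with `d ≠ D` forces `c = c'`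
  have h1 : ((c : ℤ) - c') * ((P.natDegree : ℤ) - W.natDegree) = 0 := by
    have h2 : ((ν - c : ℕ) : ℤ) = (ν : ℤ) - c := by push_cast [Nat.cast_sub hcν]; ring
    have h3 : ((ν - c' : ℕ) : ℤ) = (ν : ℤ) - c' := by push_cast [Nat.cast_sub hc'ν]; ring
    have heqZ : (((ν - c) * W.natDegree + c * P.natDegree : ℕ) : ℤ) = ((ν - c') * W.natDegree + c' * P.natDegree : ℕ) := by
      rw [heq]
    push_cast at heqZ
    rw [h2, h3] at heqZ
    linear_combination heqZ
  rcases mul_eq_zero.mp h1 with h | h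
  · exact hcc' (by exact_mod_cast sub_eq_zero.mp h)
  · exact hd (by exact_mod_cast sub_eq_zero.mp h)

/-- **A `κ`-rational root from a root curve.**  If `Σ_{c ≤ ν} C(λ_c) W^{ν−c} τ₀^c = 0` in `κ[X]` with `0 < deg W` and `λ_ν ≠ 0`, then
`τ₀ = C a * W` for some `a ∈ κ` with `Σ_{c ≤ ν} λ_c a^c = 0`. [OURS · L1 W4.3 · (o70-b)/(Δ12)] -/
theorem exists_root_of_rootCurve (ν : ℕ) (lam : ℕ → κ) (hlam : lam ν ≠ 0) (W τ₀ : κ[X]) (hW : 0 < W.natDegree)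
    (h : ∑ c ∈ Finset.range (ν + 1), C (lam c) * W ^ (ν - c) * τ₀ ^ c = 0) :
    ∃ a : κ, τ₀ = C a * W ∧ ∑ c ∈ Finset.range (ν + 1), lam c * a ^ c = 0 := by
  classical
  have hW0 : W ≠ 0 := fun h0 => by rw [h0, natDegree_zero] at hW; exact lt_irrefl 0 hW
  have hνmem : ν ∈ Finset.range (ν + 1) := Finset.mem_range.mpr (Nat.lt_succ_self ν)
  -- the root equation from `τ₀ = C a * W` (put `δ = 0` in the re-expansion)
  have root_of_eq : ∀ a : κ, τ₀ = C a * W → ∑ c ∈ Finset.range (ν + 1), lam c * a ^ c = 0 := by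
    intro a ha
    have h1 := h
    rw [taylor_rootCurve ν lam W τ₀ a, ha, sub_self] at h1
    rw [Finset.sum_eq_single 0 (fun i _ hi => by rw [zero_pow hi, mul_zero]) (fun h0 => absurd (Finset.mem_range.mpr
      (Nat.succ_pos ν)) h0), pow_zero, mul_one, Nat.sub_zero, mul_eq_zero, C_eq_zero] at h1
    rcases h1 with h1 | h1
    · simpa using h1
    · exact absurd h1 (pow_ne_zero _ hW0)
  by_cases hτ0 : τ₀ = 0
  · -- `τ₀ = 0 = C 0 * W`
    exact ⟨0, by rw [hτ0, map_zero, zero_mul], root_of_eq 0 (by rw [hτ0, map_zero, zero_mul])⟩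
  -- Step 1: `deg τ₀ = deg W`
  have hdeg : τ₀.natDegree = W.natDegree := by
    by_contra hd
    have hall := eq_zero_of_natDegree_injOn (Finset.range (ν + 1)) (fun c => C (lam c) * W ^ (ν - c) * τ₀ ^ c)
      (natDegree_term_injOn hW0 hτ0 hd) h
    have hν := hall ν hνmem
    simp only [Nat.sub_self, pow_zero, mul_one] at hν
    exact (mul_ne_zero (by rwa [Ne, C_eq_zero]) (pow_ne_zero _ hτ0)) hν
  -- Step 2: `δ = τ₀ − aW` has smaller degree, and must vanish
  set a : κ := τ₀.leadingCoeff * W.leadingCoeff⁻¹ with ha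
  have haW : (C a * W).leadingCoeff = τ₀.leadingCoeff := by
    rw [leadingCoeff_mul, leadingCoeff_C, ha, mul_assoc, inv_mul_cancel₀ (leadingCoeff_ne_zero.mpr hW0), mul_one]
  have ha0 : a ≠ 0 := by
    rw [ha]; exact mul_ne_zero (leadingCoeff_ne_zero.mpr hτ0) (inv_ne_zero (leadingCoeff_ne_zero.mpr hW0))
  set δ := τ₀ - C a * W with hδ
  by_cases hδ0 : δ = 0
  · exact ⟨a, sub_eq_zero.mp hδ0, root_of_eq a (sub_eq_zero.mp hδ0)⟩
  exfalso
  have hdegδ : δ.natDegree < W.natDegree := by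
    have hdegaW : (C a * W).degree = τ₀.degree := by
      rw [degree_C_mul ha0, degree_eq_natDegree hW0, degree_eq_natDegree hτ0, hdeg]
    have h1 := degree_sub_lt hdegaW.symm hτ0 haW.symm
    rw [degree_eq_natDegree hτ0, hdeg] at h1
    have h1' : δ.degree < W.natDegree := h1
    rw [degree_eq_natDegree hδ0] at h1'
    exact_mod_cast h1'
  have h2 := h
  rw [taylor_rootCurve ν lam W τ₀ a] at h2
  have hall := eq_zero_of_natDegree_injOn (Finset.range (ν + 1))
    (fun i => C (∑ c ∈ Finset.range (ν + 1), lam c * (c.choose i : κ) * a ^ (c - i)) * W ^ (ν - i) * δ ^ i)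
    (natDegree_term_injOn hW0 hδ0 hdegδ.ne) h2
  have hν := hall ν hνmem
  -- the `i = ν` coefficient is `λ_ν`
  have hcoef : ∑ c ∈ Finset.range (ν + 1), lam c * (c.choose ν : κ) * a ^ (c - ν) = lam ν := by
    rw [Finset.sum_eq_single ν (fun c hc hcν => by
      rw [Nat.choose_eq_zero_of_lt (lt_of_le_of_ne (Nat.lt_succ_iff.mp (Finset.mem_range.mp hc)) hcν)]; simp)
      (fun h0 => absurd hνmem h0)]
    simp
  simp only [hcoef, Nat.sub_self, pow_zero, mul_one] at hν
  exact (mul_ne_zero (by rwa [Ne, C_eq_zero]) (pow_ne_zero _ hδ0)) hν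

end Polynomial3

end Iota3

end Summit.ResolutionOfSingularities.ResolutionOfSingularities.Cruxes.HypersurfaceCentreConstruction.LocalEngine

end
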